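import Mathlib.Analysis.SpecialFunctions.Trigonometric.Sinc
import Mathlib.Analysis.SpecialFunctions.Trigonometric.Bounds
import Literature.Analysis.Fourier.BeurlingFunction
import Literature.MathematicalPhysics.QuantumFieldTheory.Balaban1983to89.B10Eq22Rescaling
import HarnessLib

/-!
# The product `SU(2)` Haar weight in exponential coordinates is `1 + O(Σ_v |A_v|²)` with a DIMENSION-FREE constant
# (layer (B3-weight), bulk factor, of the DIRECT Laplace road to ⟨stmt-QuantumFields-24204⟩ `VirialFluxGap.SharpTwistedLaplace`)

Helper module (free-hands work of width seat ym-line-sfw-p2-w3 g56, cell ym-idea-1; `--supports 24204`).  In the Pauli exponential chart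
of `SU(2)` the Haar probability has the radial density `σ(|A|) = (1/2π²)(sin|A|/|A|)²` (✓`B10Eq22Rescaling.sigmaSU2`,
✓`B10Eq18SigmaSU2Haar.lintegral_haarProbability_eq_pauli`; [Balaban1985UV3] p. 260), so the product chart on `SU(2)^n` has weight
`σ₀^n · Π_v sinc(|A_v|)²`.  The weight datum of the quantitative Laplace core ✓`laplaceMethod_quantitative_of_eqOn` (`j·φ = w₀(1 + ℓ + e)`,
`ℓ` odd, `|e| ≤ G‖y‖²`) for this bulk factor is therefore `w₀ = σ₀^n`, `ℓ = 0` (evenness) and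

  ★ `abs_prod_sinc_sq_sub_one_le`:  `|Π_{v∈s} sinc(r_v)² − 1| ≤ (Σ_{v∈s} r_v²)/3`  for ANY finite family of reals — `G = 1/3`, independent of `n`,

from `1 − x²/3 ≤ sinc(x)² ≤ 1` (`one_sub_sq_div_three_le_sinc_sq`, Mathlib `Real.sin_gt_sub_cube`, `Real.abs_sinc_le_one`) and the
Weierstrass product inequality `1 − Σε_v ≤ Π(1 − ε_v)`-type bookkeeping (`one_sub_sum_le_prod_of_le`).  Also `sigmaSU2_eq_sigma0_mul_sinc_sq`
(`σ(r) = (1/2π²)·sinc(r)²`) and the product form `abs_prod_sigmaSU2_div_sub_one_le`.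

Everything here is PROVED; no definitions, no named facts (namespace `Summit.QuantumFields.YangMills.Theorems.VirialFluxGap.ChartWeight`).
HONEST FRAMING: one-variable real analysis; ⟨24204⟩, ⟨24319⟩ and every rung stay OPEN; the Yang–Mills mass gap (Clay) is NOT touched; no summit
is proved by a line.

## References
* T. Bałaban, Commun. Math. Phys. 102 (1985) 255–275, p. 260 («σ(A) = 1/2π² (sin|A|/|A|)²»). [Balaban1985UV3]
* K. W. Breitung, *Asymptotic Approximations for Probability Integrals*, LNM 1592 (1994), Lemma 7 p. 12. [Breitung1994]
-/

set_option autoImplicit false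

noncomputable section

open scoped BigOperators
open Real

namespace Summit.QuantumFields.YangMills.Theorems.VirialFluxGap.ChartWeight

/-! ## §1 One variable: `1 − x²/3 ≤ sinc(x)²` (the upper bound `sinc² ≤ 1` is ✓`Literature.Analysis.Fourier.sinc_sq_le_one`) -/

/-- ★ `1 − x²/3 ≤ sinc(x)²` for every real `x` (from `x − x³/6 < sin x` for `x > 0`, evenness, and triviality when `x² ≥ 3`).
[cite: Breitung1994, Lemma 7 p. 12] -/
theorem one_sub_sq_div_three_le_sinc_sq (x : ℝ) : 1 - x ^ 2 / 3 ≤ Real.sinc x ^ 2 := by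
  -- reduce to `x > 0`
  suffices key : ∀ y : ℝ, 0 < y → 1 - y ^ 2 / 3 ≤ Real.sinc y ^ 2 by
    rcases lt_trichotomy x 0 with hx | hx | hx
    · have h := key (-x) (by linarith)
      rwa [Real.sinc_neg, neg_sq] at h
    · rw [hx, Real.sinc_zero]; norm_num
    · exact key x hx
  intro y hy
  by_cases hbig : 3 ≤ y ^ 2
  · have : 1 - y ^ 2 / 3 ≤ 0 := by linarith
    exact this.trans (sq_nonneg _)
  · push Not at hbig
    have hsin : y - y ^ 3 / 6 < Real.sin y := Real.sin_gt_sub_cube hy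
    have hsinc : Real.sinc y = Real.sin y / y := Real.sinc_of_ne_zero hy.ne'
    -- `sinc y > 1 − y²/6 ≥ 1/2 > 0`
    have hlow : 1 - y ^ 2 / 6 < Real.sinc y := by
      rw [hsinc, lt_div_iff₀ hy]; nlinarith
    have hpos : 0 ≤ 1 - y ^ 2 / 6 := by nlinarith
    calc 1 - y ^ 2 / 3 ≤ (1 - y ^ 2 / 6) ^ 2 := by nlinarith [sq_nonneg y]
      _ ≤ Real.sinc y ^ 2 := pow_le_pow_left₀ hpos hlow.le 2

/-! ## §2 Products: `|Π sinc² − 1| ≤ (Σ r²)/3` -/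

/-- Weierstrass-type product inequality: if `1 − ε_v ≤ a_v ≤ 1` with `ε_v ≥ 0` then `1 − Σ ε_v ≤ Π a_v ≤ 1`. [folklore] -/
theorem one_sub_sum_le_prod_of_le {ι : Type*} (s : Finset ι) {a ε : ι → ℝ} (hε : ∀ i ∈ s, 0 ≤ ε i)
    (hlow : ∀ i ∈ s, 1 - ε i ≤ a i) (hup : ∀ i ∈ s, a i ≤ 1) (hnn : ∀ i ∈ s, 0 ≤ a i) :
    1 - ∑ i ∈ s, ε i ≤ ∏ i ∈ s, a i ∧ ∏ i ∈ s, a i ≤ 1 := by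
  classical
  induction s using Finset.induction_on with
  | empty => simp
  | @insert j s hj ih =>
    have hε' : ∀ i ∈ s, 0 ≤ ε i := fun i hi => hε i (Finset.mem_insert_of_mem hi)
    have hlow' : ∀ i ∈ s, 1 - ε i ≤ a i := fun i hi => hlow i (Finset.mem_insert_of_mem hi)
    have hup' : ∀ i ∈ s, a i ≤ 1 := fun i hi => hup i (Finset.mem_insert_of_mem hi)
    have hnn' : ∀ i ∈ s, 0 ≤ a i := fun i hi => hnn i (Finset.mem_insert_of_mem hi)
    obtain ⟨ih1, ih2⟩ := ih hε' hlow' hup' hnn'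
    rw [Finset.sum_insert hj, Finset.prod_insert hj]
    have hPnn : 0 ≤ ∏ i ∈ s, a i := Finset.prod_nonneg hnn'
    have hSnn : 0 ≤ ∑ i ∈ s, ε i := Finset.sum_nonneg hε'
    have haj := hnn j (Finset.mem_insert_self j s)
    have haj1 := hup j (Finset.mem_insert_self j s)
    have hajl := hlow j (Finset.mem_insert_self j s)
    have hεj := hε j (Finset.mem_insert_self j s)
    constructor
    · -- `1 − ε_j − S ≤ a_j · P` : from `a_j ≥ 1 − ε_j`, `P ≥ 1 − S`, `a_j ≤ 1`, `P ≥ 0`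
      nlinarith [mul_le_mul_of_nonneg_left ih1 haj, mul_nonneg hεj hSnn]
    · calc a j * ∏ i ∈ s, a i ≤ 1 * 1 := mul_le_mul haj1 ih2 hPnn zero_le_one
        _ = 1 := one_mul 1

/-- ★ **The product `sinc²` weight is `1 + O(Σ r²)` with constant `1/3`, uniformly in the number of factors.**
[cite: Balaban1985UV3, p. 260] [cite: Breitung1994, Lemma 7 p. 12] -/
theorem abs_prod_sinc_sq_sub_one_le {ι : Type*} (s : Finset ι) (r : ι → ℝ) :
    |(∏ i ∈ s, Real.sinc (r i) ^ 2) - 1| ≤ (∑ i ∈ s, r i ^ 2) / 3 := by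
  have h := one_sub_sum_le_prod_of_le s (a := fun i => Real.sinc (r i) ^ 2) (ε := fun i => r i ^ 2 / 3)
    (fun i _ => by positivity) (fun i _ => one_sub_sq_div_three_le_sinc_sq (r i)) (fun i _ => Literature.Analysis.Fourier.sinc_sq_le_one (r i))
    (fun i _ => sq_nonneg (Real.sinc (r i)))
  obtain ⟨h1, h2⟩ := h
  rw [← Finset.sum_div] at h1
  rw [abs_le]
  constructor <;> linarith

/-! ## §3 The `SU(2)` density `σ` of [Balaban1985UV3] p. 260 -/

open Literature.MathematicalPhysics.QuantumFieldTheory.Balaban1983to89 in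
/-- `σ_{SU(2)}(r) = (1/2π²)·sinc(r)²`. [cite: Balaban1985UV3, p. 260] -/
theorem sigmaSU2_eq_sigma0_mul_sinc_sq (r : ℝ) : B10Eq22Rescaling.sigmaSU2 r = 1 / (2 * Real.pi ^ 2) * Real.sinc r ^ 2 := by
  unfold B10Eq22Rescaling.sigmaSU2
  rw [Real.sinc_apply]

open Literature.MathematicalPhysics.QuantumFieldTheory.Balaban1983to89 in
/-- ★ **Product form for the `SU(2)` Haar density**: `|Π_v σ(r_v) / σ₀^{|s|} − 1| ≤ (Σ_v r_v²)/3`, `σ₀ = σ(0) = 1/2π²` — the weight datum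
`e` (with `ℓ = 0`) of the quantitative Laplace method for the bulk product exponential chart, `G = 1/3` INDEPENDENT of the number of
variables. [cite: Balaban1985UV3, p. 260] [cite: Breitung1994, Lemma 7 p. 12] -/
theorem abs_prod_sigmaSU2_div_sub_one_le {ι : Type*} (s : Finset ι) (r : ι → ℝ) :
    |(∏ i ∈ s, B10Eq22Rescaling.sigmaSU2 (r i)) / (1 / (2 * Real.pi ^ 2)) ^ s.card - 1| ≤ (∑ i ∈ s, r i ^ 2) / 3 := by
  have hσ0 : (0 : ℝ) < 1 / (2 * Real.pi ^ 2) := by positivity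
  have e : (∏ i ∈ s, B10Eq22Rescaling.sigmaSU2 (r i)) = (1 / (2 * Real.pi ^ 2)) ^ s.card * ∏ i ∈ s, Real.sinc (r i) ^ 2 := by
    rw [Finset.prod_congr rfl fun i _ => sigmaSU2_eq_sigma0_mul_sinc_sq (r i), Finset.prod_mul_distrib, Finset.prod_const]
  have e2 : (1 / (2 * Real.pi ^ 2)) ^ s.card * (∏ i ∈ s, Real.sinc (r i) ^ 2) / (1 / (2 * Real.pi ^ 2)) ^ s.card =
      ∏ i ∈ s, Real.sinc (r i) ^ 2 := by
    field_simp
  rw [e, e2]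
  exact abs_prod_sinc_sq_sub_one_le s r

end Summit.QuantumFields.YangMills.Theorems.VirialFluxGap.ChartWeight

end
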